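import Literature.MathematicalPhysics.QuantumFieldTheory.Balaban1983to89.B11SectGPerturbedComposition
import Summits.QuantumFields.YangMills.Theorems.BalabanUVNodesN09MembershipSupportClauseReading

/-!
# NODE N09 — (L1b) BOOKKEEPING OF THE [B11] SECT. G NAMED FACT `SectGLocalisedMinimiser` (director-ym №320 (4) OPTION (L)): monotonicity, the `L⁻²` ROOM `bgReg K (k+1) ρ = bgReg K k (ρ∕L²)`
# of [I] p. 265's use, the specialisation at the critical configuration `V^{(k)}(W) = M^k(U_{k+1}(W))`, and the inhabitation of the room row `ρ∕L² + B₅ε₁ ≤ ρ` — the pieces (L2) composes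
# into the inhabitant of the door's row `hmemχ` (membership of the χ₂₉-support, ✓p748582)

TRACK A (YM-PLAN §2d, node N09 of 28), seat `pub-ymgap-dag-n09-w1` g8, file 11 of the (G-a)∕(L) set.  Key of record K1⁹ stmt-QuantumFields-27364 (`--supports … --as helper`, count-neutral).
[I] = [Balaban1987RG1], [B11] = [Balaban1985Variational].  Imports the named fact (Literature, statement-only) and the door's reading file.  THEOREMS ONLY (0 `def`, 0 `sorry`).
HONEST FRAMING: bookkeeping around a NAMED FACT (asserted by nobody; every consumer CONDITIONAL on `(hG : SectGLocalisedMinimiser …)`); nothing of Bałaban's asserted; K-texts untouched;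
FLAG №7′ OPEN (WORK-BOUND (L)); N09 ∕ N07 ∕ N24 NOT discharged; counts unmoved; R4 = the conditional finite-𝕋⁴ rung only; the YM mass gap (Clay) is NOT proved.
-/

noncomputable section

namespace Summit.QuantumFields.YangMills.BalabanUVNodes.N09SectGCompositionBookkeeping

open Literature.MathematicalPhysics.QuantumFieldTheory.Balaban1983to89
open Literature.MathematicalPhysics.QuantumFieldTheory.Balaban1983to89.T4Continuum (T4Family)
open Literature.MathematicalPhysics.QuantumFieldTheory.Balaban1983to89.Node00
open Literature.MathematicalPhysics.QuantumFieldTheory.Balaban1983to89.B11SectGPerturbedComposition (SectGLocalisedMinimiser)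
open Summit.QuantumFields.YangMills.BalabanUVNodes.N09BackgroundRadiiTransfer (bgReg_mono)

variable {F : T4Family} {N : ℕ} [NeZero N]


/-! ## §2. Bookkeeping: monotonicity, the `L⁻²` room, the specialisation [I] p. 265 uses -/

/-- Weakening the named fact's conversion letter: a localisation with `κ` gives one with any `κ′ ≥ κ` (`B₅ ≥ 0`). [cite: Balaban1985Variational, (173) p.305 (bookkeeping)] -/
theorem sectGLocalisedMinimiser_mono {B₃ B₅ C₁ a₀ a₁ κ κ' : ℝ} (hκ : κ ≤ κ') (hB₅ : 0 ≤ B₅) (h : SectGLocalisedMinimiser F N B₃ B₅ C₁ a₀ a₁ κ) :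
    SectGLocalisedMinimiser F N B₃ B₅ C₁ a₀ a₁ κ' := by
  intro K k ε₁ ε₀ r₀ V₀ V' h₁ h₂ h₃ h₄ h₅ h₆ h₇ h₈ h₉ h₁₀ h₁₁
  exact bgReg_mono (by nlinarith [mul_nonneg hB₅ h₁.le]) (h K k ε₁ ε₀ r₀ V₀ V' h₁ h₂ h₃ h₄ h₅ h₆ h₇ h₈ h₉ h₁₀ h₁₁)

/-- **THE `L⁻²` ROOM** of [I] p. 265's use: the level-`(k+1)` class of radius `ρ` IS the level-`k` class of radius `ρ∕L²` (`η_{k+1} = η_k∕L`): a minimiser that is `ρ`-regular for step `k+1`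
is `ρ∕L²`-regular as a level-`k` background — the room the fluctuation `B₅ε₁` has to fit in. [cite: Balaban1987RG1, (1.2) p.260 and p.265 (bookkeeping)] -/
theorem bgReg_succ_eq_div_Lsq (K k : ℕ) (ρ : ℝ) : bgReg F N K (k + 1) ρ = bgReg F N K k (ρ / ((F.P K).L : ℝ) ^ 2) := by
  ext U
  rw [mem_bgReg_iff, mem_bgReg_iff]
  have hL : ((F.P K).L : ℝ) ≠ 0 := Nat.cast_ne_zero.mpr (ne_of_gt (F.P K).L_pos)
  have he : (F.P K).eta (k + 1) = (F.P K).eta k * ((F.P K).L : ℝ)⁻¹ := by unfold Params.eta; rw [pow_succ]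
  have h : ρ * (F.P K).eta (k + 1) ^ 2 = ρ / ((F.P K).L : ℝ) ^ 2 * (F.P K).eta k ^ 2 := by
    rw [he, mul_pow, inv_pow, div_eq_mul_inv]; ring
  rw [h]

/-- **THE SPECIALISATION [I] p. 265 USES** («As in Sect. G [15] we write U_k(V′V^{(k)}) = U′_k(V′)U_{k+1}»): with `V₀ := V^{(k)}(W) = M^k(U_{k+1}(W))` the critical configuration of (2.3) over a
datum `W` whose level-`(k+1)` minimiser of record lies in `bgReg K (k+1) ρ` (membership radius `ρ`) — so `U_{k+1}(W)` is a `ρ∕L²`-regular LEVEL-`k` background over `V₀` — the named fact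
localises the minimiser of record of the perturbed datum `V′·V₀` in `bgReg K k (ρ∕L² + κB₅ε₁)`, PROVIDED the level-`k` minimiser of record over `V₀` is (a residual transform of)
`U_{k+1}(W)` — the composition input `hcomp` ((0.23)∕`HRestrict`-type, displayed).  CONDITIONAL on the named fact and the displayed rows; nothing of Bałaban asserted.
[cite: Balaban1987RG1, (2.3) p.265 and (1.2) p.260; Balaban1985Variational, (172)–(173) p.305 and Prop. 9 p.309] -/
theorem localised_at_critCfg {B₃ B₅ C₁ a₀ a₁ κ : ℝ} (hG : SectGLocalisedMinimiser F N B₃ B₅ C₁ a₀ a₁ κ) {K k : ℕ} {ε₁ ε₀ ρ : ℝ}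
    {W : GaugeField (F.P K) (k + 1) (SU N)} {V' : GaugeField (F.P K) k (SU N)}
    (h₁ : 0 < ε₁) (h₂ : ε₁ ≤ a₁) (h₃ : B₃ * ε₁ ≤ ε₀) (h₄ : ε₀ ≤ a₀)
    (hV₀ : PlaqSmall ε₁ (Averaging.iter (avOfRecord F N K) k (Uk F N K (k + 1) ε₀ W)))
    (hex : UkExists F N K k ε₀ (Averaging.iter (avOfRecord F N K) k (Uk F N K (k + 1) ε₀ W)))
    (hun : UniqueUkOrbit F N K k ε₀ (Averaging.iter (avOfRecord F N K) k (Uk F N K (k + 1) ε₀ W)))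
    (hcomp : Uk F N K k ε₀ (Averaging.iter (avOfRecord F N K) k (Uk F N K (k + 1) ε₀ W)) ∈ bgReg F N K k (ρ / ((F.P K).L : ℝ) ^ 2))
    (hV' : ∀ b : PBond (F.P K) k, dist1 (V' b) < C₁ * ε₁)
    (hex' : UkExists F N K k ε₀ (fun b => V' b * Averaging.iter (avOfRecord F N K) k (Uk F N K (k + 1) ε₀ W) b))
    (hun' : UniqueUkOrbit F N K k ε₀ (fun b => V' b * Averaging.iter (avOfRecord F N K) k (Uk F N K (k + 1) ε₀ W) b)) :
    Uk F N K k ε₀ (fun b => V' b * Averaging.iter (avOfRecord F N K) k (Uk F N K (k + 1) ε₀ W) b) ∈ bgReg F N K k (ρ / ((F.P K).L : ℝ) ^ 2 + κ * B₅ * ε₁) :=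
  hG K k ε₁ ε₀ (ρ / ((F.P K).L : ℝ) ^ 2) _ V' h₁ h₂ h₃ h₄ hV₀ hex hun hcomp hV' hex' hun'

/-- **MEMBERSHIP IS KEPT** when the room suffices: under `localised_at_critCfg`'s hypotheses (`c := κB₅`) and `ρ∕L² + cε₁ ≤ ρ` the minimiser of record of the perturbed datum is again `ρ`-regular —
the membership conjunct of NODE N09's row `hmemχ` in print's currency. [cite: Balaban1987RG1, p.265; Balaban1985Variational, Prop. 9 p.309] -/
theorem mem_bgReg_of_localised_of_room {K k : ℕ} {ε₁ ε₀ ρ c : ℝ} {V : GaugeField (F.P K) k (SU N)}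
    (h : Uk F N K k ε₀ V ∈ bgReg F N K k (ρ / ((F.P K).L : ℝ) ^ 2 + c * ε₁)) (hroom : ρ / ((F.P K).L : ℝ) ^ 2 + c * ε₁ ≤ ρ) :
    Uk F N K k ε₀ V ∈ bgReg F N K k ρ :=
  bgReg_mono hroom h

/-- **THE ROOM IS INHABITED**: for `L ≥ 2` (any family: `L ≥ 12`), `0 < ρ`, `0 ≤ c` (`c := κB₅ = 6κB₁B₃C₁`) and a fluctuation size `ε₁ ≤ ρ∕(2(c + 1))` (any sign), `ρ∕L² + cε₁ ≤ ρ` — [I] Thm 3 p.264 «the constants ε₀, ε₁ … satisfy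
numerous restrictions» has a witness in this row. [cite: Balaban1987RG1, Thm 3 p.264 and p.265 (bookkeeping)] -/
theorem room_of_small_fluctuation {K : ℕ} {ε₁ ρ c : ℝ} (hρ : 0 < ρ) (hB : 0 ≤ c) (hε₁ : ε₁ ≤ ρ / (2 * (c + 1))) :
    ρ / ((F.P K).L : ℝ) ^ 2 + c * ε₁ ≤ ρ := by
  have hL : (2 : ℝ) ≤ (F.P K).L := by exact_mod_cast (F.P K).hL.2
  have hL2 : (4 : ℝ) ≤ ((F.P K).L : ℝ) ^ 2 := by nlinarith
  have h1 : ρ / ((F.P K).L : ℝ) ^ 2 ≤ ρ / 4 := div_le_div_of_nonneg_left hρ.le (by norm_num) hL2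
  have h2 : c * ε₁ ≤ ρ / 2 := by
    have hB1 : 0 < c + 1 := by linarith
    calc c * ε₁ ≤ c * (ρ / (2 * (c + 1))) := mul_le_mul_of_nonneg_left hε₁ hB
      _ = (c / (c + 1)) * (ρ / 2) := by field_simp
      _ ≤ 1 * (ρ / 2) := by
          apply mul_le_mul_of_nonneg_right _ (by linarith)
          rw [div_le_one hB1]; linarith
      _ = ρ / 2 := one_mul _
  linarith

end Summit.QuantumFields.YangMills.BalabanUVNodes.N09SectGCompositionBookkeeping

end
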